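import Summits.NavierStokesRegularity.NavierStokesRegularity.Theses.FrozenSignCascade
import Summits.NavierStokesRegularity.NavierStokesRegularity.Theorems.FrozenSignCascadeBoundedEnvelopeContinuationMorreyOfEnvelope
import Summits.NavierStokesRegularity.NavierStokesRegularity.Theorems.FrozenSignCascadeBoundedEnvelopeContinuationStateOfKato
import Summits.NavierStokesRegularity.NavierStokesRegularity.Theorems.FrozenSignCascadeBoundedEnvelopeContinuationBackwardBoundedOfMorrey
import Summits.NavierStokesRegularity.NavierStokesRegularity.Theorems.FrozenSignCascadeBoundedEnvelopeContinuationClayOfBackwardBounded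
import Literature.Analysis.FluidPDE.NSCriticalClosureBesovKatoClass
import HarnessLib

/-!
# Route FrozenSignCascade · crux `BoundedEnvelopeContinuation` (stmt-NavierStokesRegularity-10579)
(conditional proof: (B) holds if no local Type I singularity exists)

**Theorem (`boundedEnvelopeContinuation_of_not_localTypeISingularityExists`).** Assume the
registered open statement `Literature.Analysis.FluidPDE.LocalTypeISingularityExists`
(Albritton–Barker 2019, Thm. 1.1, first bullet: "there exists a suitable weak solution with Type I
singular point") FAILS — as it does under the Liouville conjecture (L) of
Koch–Nadirashvili–Seregin–Šverák 2009 together with the Albritton–Barker forward characterisation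
(`AlbrittonBarkerForward`). Then the route decl
`Summit.NavierStokesRegularity.NavierStokesRegularity.Theses.FrozenSignCascade.BoundedEnvelopeContinuation`
holds: for `ν > 0` and a Clay datum `u₀`, if at every horizon `T₀` the critical Fourier envelope
`‖ξ‖² ‖V(t,ξ)‖` of all Fourier-side mild solutions `V` on `[0,T]`, `T ≤ T₀`, from `𝓕⁻¹u₀` is
bounded by one constant, then `u₀` launches a global smooth bounded-energy (Clay) solution.

**Why (the mathematics).** A bounded critical envelope `|û(t,ξ)| ≤ C|ξ|⁻²` (`u(t) ∈ PM²`, the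
Le Jan–Sznitman space) places every slice in the critical Morrey class:
`∫_{B_r(x₁)} |u(t)|² ≤ κ C² r` for all balls (`PM² ⊂ Ṁ^{2,1}`: frequencies `≤ 1/r` contribute
pointwise `≤ 3|B₁|C/r`, frequencies `≥ 1/(2r)` contribute `≤ 18|B₁|C²r` in `L²(ℝ³)` by
Plancherel; `stub_morreyOfEnvelope`). This is the scale-invariant quantity `A` of
Caffarelli–Kohn–Nirenberg, bounded on ALL parabolic balls; by Seregin 2006 / Albritton–Barker 2019,
Lemma 2.6 (`albrittonBarker2019_lemma_2_6_holds`) it bounds `C, D, E` as well, so the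
viscosity-normalising zoom of the solution about any final-time point `(T, x₀)` is a suitable weak
solution in `Q(0,1)` with finite Type-I quantity `𝐈(Q(0,1/2)) < ∞`
(`stub_backwardBoundedOfMorrey`, the Seregin–Šverák 2002/2009 zoom). Hence, if `u` were unbounded
near `(T, x₀)`, the origin would be a local Type I singular point of the zoom — excluded by the
hypothesis; so `u` is backward bounded at every `(T, x₀)`. Finally, a datum all of whose classical
Leray–Hopf solutions are backward bounded at every final-time point has infinite Kato maximal time
(at a finite maximal time the maximal Kato solution has a singular point, Lemarié-Rieusset 2016,
Thm. 15.1 (C)), hence a global Kato solution, hence a Clay solution (von Wahl / Kato: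
`clay_solution_of_hasGlobalKatoSolution_holds`) — `stub_clayOfBackwardBounded`, the per-datum form
of item 0055 `navierStokesRegularity_of_noBlowup`. The Fourier representation `u t = synthVel (V t)`
needed to apply the envelope hypothesis to the physical solution comes from `stub_stateOfKato`
(`C([0,T);L³)` is a regularity class, Fourier side exposed) and Kato uniqueness
(`IsTaoSolutionOn.ae_eq_of_kato_Icc`).

In words: **every blow-up compatible with hypothesis (B) is Type I** (in the sense of bounded
scale-invariant energy quantities), so (B) is implied by — and is the `PM²` shadow of — the
non-existence of Type I singularities; the converse implication is not claimed. This file is a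
CONDITIONAL result (`--supports` the crux item; it does not close it): the open content of the crux
is now the named registered statement `¬ LocalTypeISingularityExists`.
-/

noncomputable section

set_option linter.dupNamespace false -- nested layout Summit.<S>.<Sub>, Sub = S (D-0017)

open Set MeasureTheory Filter Topology
open scoped ENNReal
open Literature.Analysis.FluidPDE Literature.Analysis.FluidPDE.FourierNS

namespace Summit.NavierStokesRegularity.NavierStokesRegularity.Theorems.BoundedEnvelope

/-- **Crux (B) of route `FrozenSignCascade` from the non-existence of local Type I singular
points.** If no suitable weak solution of the unforced unit-viscosity Navier–Stokes system has a
Type I singular point in the sense of Albritton–Barker 2019, Thm. 1.1 (`¬ LocalTypeISingularityExists`),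
then `BoundedEnvelopeContinuation` holds: a bounded critical Fourier envelope along all Fourier-side
mild solutions from a Clay datum, at every horizon, implies a global smooth bounded-energy solution.
Composition of the four landed stubs of the line (`stub_morreyOfEnvelope`, `stub_stateOfKato`,
`stub_backwardBoundedOfMorrey`, `stub_clayOfBackwardBounded`): every potential blow-up under the
envelope bound is locally Type I (critical Morrey bound ⇒ Seregin–Šverák zoom with `𝐈 < ∞`).
[cite: AlbrittonBarker2019, Thm. 1.1 and Lemma 2.6; LemarieRieusset2016, Thm. 15.1 (C), Prop. 12.3] -/
theorem boundedEnvelopeContinuation_of_not_localTypeISingularityExists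
    (hno : ¬ Literature.Analysis.FluidPDE.LocalTypeISingularityExists) :
    Summit.NavierStokesRegularity.NavierStokesRegularity.Theses.FrozenSignCascade.BoundedEnvelopeContinuation := by
  intro ν hν u₀ hu hd hdiv hbdd
  refine stub_clayOfBackwardBounded ν hν u₀ hu hd hdiv ?_
  intro T hT u p hsol hLH hu0 x₀
  -- the classical Leray–Hopf solution is a Kato solution on `[0, T)`
  have hLH' : IsLerayHopfOn T ν 0 (u 0) u := by rw [hu0]; exact hLH
  have hd0 : HasRapidSpatialDecay (u 0) := by rw [hu0]; exact hd
  have hK : IsKatoSolutionOn T ν u₀ u := by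
    have h := isKatoSolutionOn_of_classical hν hT hsol hLH' hd0
    rwa [hu0] at h
  -- the envelope constant at horizon `T` and the Morrey constant
  obtain ⟨C, hC⟩ := hbdd T hT
  obtain ⟨κ, _, hMor⟩ := stub_morreyOfEnvelope
  refine stub_backwardBoundedOfMorrey hno ν T hν hT u p hsol hLH' ⟨κ * C ^ 2, ?_⟩ x₀
  refine (ae_restrict_mem measurableSet_Ioo).mono fun t ht x₁ r hr _ => ?_
  -- a Tao-class state with Fourier side on `[0, Tt]`, `t < Tt < T`
  set Tt : ℝ := (t + T) / 2 with hTt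
  have hTt0 : 0 < Tt := by rw [hTt]; linarith [ht.1, ht.2]
  have htTt : t < Tt := by rw [hTt]; linarith [ht.2]
  have hTtT : Tt < T := by rw [hTt]; linarith [ht.2]
  obtain ⟨u', p', V, hTao, hV, hsyn, hV0⟩ :=
    stub_stateOfKato ν hν u₀ hu hd hdiv T u hK Tt hTt0 hTtT
  -- identification `u' t = u t` (uniqueness in `C_t L³` and continuity of both slices)
  have htI : t ∈ Icc 0 Tt := ⟨ht.1.le, htTt.le⟩
  have hae : u' t =ᵐ[volume] u t :=
    hTao.ae_eq_of_kato_Icc hν hTt0 (hK.mild.mono (Ico_subset_Ico_right hTtT.le))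
      (hK.continuousInLpOn.mono fun s hs => ⟨hs.1, lt_of_le_of_lt hs.2 hTtT⟩)
      (hK.aestronglyMeasurable.mono_measure (Measure.restrict_mono
        (Set.prod_mono (Ioo_subset_Ioo_right hTtT.le) Subset.rfl) le_rfl)) t htI
  have heq : u' t = u t :=
    (Continuous.ae_eq_iff_eq volume (hTao.classical.contDiff_velocity htI).continuous
      (hsol.contDiff_velocity ⟨ht.1.le, ht.2⟩).continuous).1 hae
  -- the envelope bound on `V t`, hence the Morrey bound on `u t = synthVel (V t)`
  have henv : ∀ ξ : EuclideanSpace ℝ (Fin 3), ‖ξ‖ ^ 2 * ‖V t ξ‖ ≤ C :=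
    fun ξ => hC Tt hTtT.le V hV hV0 t htI ξ
  have hC0 : 0 ≤ C := le_trans (by positivity) (henv 0)
  have hdecV : ∀ K : ℕ, ∃ B, HasDecay K B (V t) := fun K => by
    obtain ⟨B, hB⟩ := hV.decay K
    exact ⟨B, hB t⟩
  have hm := hMor C (V t) hC0 (hV.continuous_slice t) hdecV (fun ξ l => hV.conjSymm t ξ l) henv
    x₁ r hr
  rw [← heq, hsyn t htI]
  exact hm

/-- **Registered stub `stub_ofNoLocalTypeISingularity` of the line's skeleton** (crux
stmt-NavierStokesRegularity-10579, `Cruxes/BoundedEnvelopeContinuation/Lines/birth.lean`): the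
implication `¬ LocalTypeISingularityExists → BoundedEnvelopeContinuation`, by name, so that the
skeleton's composition `BoundedEnvelopeContinuation_of := stub_ofNoLocalTypeISingularity
stub_noLocalTypeISingularity` is closed modulo the single open stub `stub_noLocalTypeISingularity`
(= item stmt-NavierStokesRegularity-10480 `StretchingWellBinding.NoLocalTypeISingularity`, `Iff.rfl`).
[cite: AlbrittonBarker2019, Thm. 1.1 and Lemma 2.6; LemarieRieusset2016, Thm. 15.1 (C), Prop. 12.3] -/
theorem stub_ofNoLocalTypeISingularity :
    ¬ Literature.Analysis.FluidPDE.LocalTypeISingularityExists →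
      Summit.NavierStokesRegularity.NavierStokesRegularity.Theses.FrozenSignCascade.BoundedEnvelopeContinuation :=
  boundedEnvelopeContinuation_of_not_localTypeISingularityExists

end Summit.NavierStokesRegularity.NavierStokesRegularity.Theorems.BoundedEnvelope

end
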